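import Summits.QuantumFields.BalabanUV.Beta.D1BFx.ReducedKernelSandwichLeg

/-!
# `BalabanUV.Beta.D1BFx.PackedWordPairing` — road «BF-x» for binder row D1, slot (K), junction (J3), brick (B2) second half, GENERIC CORE 3:
# **THE ONE-LOOP WORD OF A LEG AT STENCILS ∕ TABLES PACKED WITH A DECAYING WEIGHT FAMILY IS THE JOINT PAIRING OF THE FINE HESSIAN WITH THE
# WEIGHTS** — `hessKer A (Σ_κ wsum (w μ y κ) (S κ)) (Σ_κ wsum (w μ y κ) (u ↦ Σ_l wsum (w ν y′ l) (W κ u l))) μ ν z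
# = Σ_κ Σ_l Σ'_{q} w μ 0 κ q.1 · w ν z l q.2 · fineHessA A S W κ l q.1 q.2` for ANY weight family `w` with `|w μ y κ u| ≤ Cw·e^{−δw|u − P μ y|₁}`
# (the road's `colH K₀` AND `colH G₀` are such — `DressedTablesLeg.bubble_vertexRedF` ∕ `tadpole_tableRedF` are the `wH` instance).

HONEST DEPENDENCY (cell records, verbatim): «continuum YM on T⁴ ⇐ BetaPertH ∧ nine spine estimates (0/9 proved); BetaPertH ⇐ (D1) ∧ (D4) ∧
CAP+tail; G-an2-4 gates asym, D1 and NE2/3/4.»  HONEST FRAMING (cell contract, verbatim): «discharging `BetaPertH` makes Bałaban's UV stability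
UNCONDITIONAL — a real constructive-QFT result; it is NOT the continuum limit and NOT the Clay problem.»  THIS MODULE DISCHARGES NOTHING of the
wall: [folklore] composition BY NAME of `DressedBubbleBridge.bubble_wsum_wsum` ∕ `loc_wsum` ∕ `bubble_finset_sum_*`, `DressedTadpoleTable.tadpole_wsum_wsum`
∕ `biLoc_wsum_fst/snd`, `KernelWardRelative.tadpole_finset_sum`; hypotheses only; nothing of Bałaban's.  No definition, no `def … : Prop`, no notation,
nothing cited, 0 sorry.  0 root-level binders of row D1 discharged (hW ∕ hR-sockets ∕ hSX-socket ∕ D1Tel ∕ D1Rep — 0); (J3) DISPLAYED; (K) NOT closed;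
NOT D1, NOT `BetaPertH`, NOT continuum, NOT Clay.

ABSOLUTE RULE (cell charter, verbatim): «No internally-minted statement may enter as a cited fact. Every hypothesis is either kernel-proved in
this package or a verbatim quotation of a PUBLISHED theorem with page reference. The manuscript(s) under audit are NOT citable for their own
disputed steps — they are the thing under adjudication; programme-internal (2001/route/tribunal) claims are never citable.»

Unit `b2b-balaban-beta-d1-formalise-leaf-04` (gen 21), D1 formalisation swarm leaf prover 04, road «BF-x»; (B2) second half per R-D1-g40-1 ∕ ρ-g19-4 (journal).
-/

noncomputable section

open Finset
open scoped BigOperators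
open Literature.MathematicalPhysics.QuantumFieldTheory
open Literature.MathematicalPhysics.QuantumFieldTheory.Balaban1983to89
open Literature.MathematicalPhysics.QuantumFieldTheory.Balaban1983to89.Beta
open B12Sec2to5 (l1 l1_nonneg)
open ExpKernelCalculus (Site MKer BiLoc Zl hessKer bubble tadpole)
open OneStepResolventKernel (wsum biLoc_wsum)
open Summit.QuantumFields.BalabanUV.Beta.TameKernelCalculus (Spr Loc biLoc_of_le)
open Summit.QuantumFields.BalabanUV.Beta.KernelWardRelative (loc_finset_sum tadpole_finset_sum bubble_finset_sum_left)
open Summit.QuantumFields.BalabanUV.Beta.D1BFx.DressedBubbleBridge (bubble_wsum_wsum loc_wsum bubble_finset_sum_right expWeight_of_le)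
open Summit.QuantumFields.BalabanUV.Beta.D1BFx.DressedTadpoleTable (tadpole_wsum_wsum biLoc_wsum_fst biLoc_wsum_snd)
open Summit.QuantumFields.BalabanUV.Beta.D1BFx.ReducedKernelSandwichLeg (fineHessA fineHessA_apply)
open Summit.QuantumFields.BalabanUV.Beta.D1BFx.DressedTablesLeg (tadpoleTableA_apply bubbleTableA_apply)

namespace Summit.QuantumFields.BalabanUV.Beta.D1BFx.PackedWordPairing

variable {F : Type*} [Fintype F] [Nonempty F]

variable {A : MKer 4 F} (hA : Spr A) {S : Fin 4 → Site 4 → MKer 4 F} {W : Fin 4 → Site 4 → Fin 4 → Site 4 → MKer 4 F} {Cs C2 δ : ℝ}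
  (hS : ∀ κ u, BiLoc (S κ u) u u Cs δ) (hW : ∀ κ u l u', BiLoc (W κ u l u') u u' C2 δ) (hδ : 0 < δ)
  {w : Fin 4 → Site 4 → Fin 4 → Site 4 → ℝ} {Cw δw : ℝ} {P : Fin 4 → Site 4 → Site 4}
  (hw : ∀ μ y κ u, |w μ y κ u| ≤ Cw * Real.exp (-δw * l1 (u - P μ y))) (hCw : 0 ≤ Cw) (hδw : 0 < δw)

section Loc
include hS hδ hw hCw hδw

omit [Fintype F] [Nonempty F] in
/-- [folklore] One packed stencil jet `wsum (w μ y κ) (S κ)` is localised (`DressedBubbleBridge.loc_wsum` at the common rate `min δw δ`). -/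
theorem loc_packed_stencil (μ : Fin 4) (y : Site 4) (κ : Fin 4) : Loc (wsum (w μ y κ) (S κ)) := by
  have hm : 0 < min δw δ := lt_min hδw hδ
  exact loc_wsum (fun u => expWeight_of_le (hw μ y κ) hCw (min_le_left _ _) u) hCw
    (fun u => biLoc_of_le (hS κ u) (min_le_right _ _)) hm

end Loc

section LocTable
include hW hδ hw hCw hδw

omit [Fintype F] [Nonempty F] in
/-- [folklore] One packed `(κ, l)` table summand `wsum (w μ y κ) (u ↦ wsum (w ν y′ l) (W κ u l))` is localised (`biLoc_wsum_snd` then `biLoc_wsum_fst`). -/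
theorem loc_packed_table (μ : Fin 4) (y : Site 4) (ν : Fin 4) (y' : Site 4) (κ l : Fin 4) :
    Loc (wsum (w μ y κ) (fun u => wsum (w ν y' l) (W κ u l))) := by
  have hm : 0 < min δw δ := lt_min hδw hδ
  have hin : ∀ u, BiLoc (wsum (w ν y' l) (W κ u l)) u (P ν y') (Cw * |C2| * Zl 4 (min δw δ / 2)) (min δw δ / 2) := fun u =>
    biLoc_wsum_snd (fun u' => expWeight_of_le (hw ν y' l) hCw (min_le_left _ _) u')
      (fun u' => biLoc_of_le (hW κ u l u') (min_le_right _ _)) hm hCw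
  have hm' : 0 < min δw (min δw δ / 2) := lt_min hδw (half_pos hm)
  exact ⟨P μ y, P ν y', _, _, half_pos hm',
    biLoc_wsum_fst (fun u => expWeight_of_le (hw μ y κ) hCw (min_le_left _ _) u)
      (fun u => biLoc_of_le (hin u) (min_le_right _ _)) hm' hCw⟩

end LocTable

section Bubble
include hA hS hδ hw hCw hδw

/-- [folklore] **THE BUBBLE OF TWO PACKED STENCIL JETS** is the joint pair-sum of the weights against the stencil bubbles (any decaying
weight family; the `wH` instance is `DressedTablesLeg.bubble_vertexRedF`). -/
theorem bubble_packed (μ : Fin 4) (y : Site 4) (ν : Fin 4) (y' : Site 4) :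
    bubble A (∑ κ : Fin 4, wsum (w μ y κ) (S κ)) (∑ κ : Fin 4, wsum (w ν y' κ) (S κ))
      = ∑ κ : Fin 4, ∑ l : Fin 4, ∑' q : Site 4 × Site 4, w μ y κ q.1 * w ν y' l q.2 * bubble A (S κ q.1) (S l q.2) := by
  rw [bubble_finset_sum_left _ hA (fun κ => loc_packed_stencil hS hδ hw hCw hδw μ y κ)
    (loc_finset_sum _ fun l => loc_packed_stencil hS hδ hw hCw hδw ν y' l)]
  refine Finset.sum_congr rfl fun κ _ => ?_
  rw [bubble_finset_sum_right _ hA (loc_packed_stencil hS hδ hw hCw hδw μ y κ) (fun l => loc_packed_stencil hS hδ hw hCw hδw ν y' l)]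
  refine Finset.sum_congr rfl fun l _ => ?_
  exact bubble_wsum_wsum hA (hw μ y κ) hδw (hw ν y' l) hCw hδw (fun u => hS κ u) (fun u => hS l u) hδ

end Bubble

section Tadpole
include hA hW hδ hw hCw hδw

/-- [folklore] **THE TADPOLE OF THE PACKED TWO-BOND TABLE** is the joint pair-sum of the weights against the fine tadpoles (the `wH` instance
is `DressedTablesLeg.tadpole_tableRedF`). -/
theorem tadpole_packed (μ : Fin 4) (y : Site 4) (ν : Fin 4) (y' : Site 4) :
    tadpole A (∑ κ : Fin 4, ∑ l : Fin 4, wsum (w μ y κ) (fun u => wsum (w ν y' l) (W κ u l)))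
      = ∑ κ : Fin 4, ∑ l : Fin 4, ∑' q : Site 4 × Site 4, w μ y κ q.1 * w ν y' l q.2 * tadpole A (W κ q.1 l q.2) := by
  rw [tadpole_finset_sum _ hA (fun κ => loc_finset_sum _ fun l => loc_packed_table hW hδ hw hCw hδw μ y ν y' κ l)]
  refine Finset.sum_congr rfl fun κ _ => ?_
  rw [tadpole_finset_sum _ hA (fun l => loc_packed_table hW hδ hw hCw hδw μ y ν y' κ l)]
  refine Finset.sum_congr rfl fun l _ => ?_
  exact tadpole_wsum_wsum hA (hw μ y κ) hδw (hw ν y' l) hCw hδw (fun u u' => hW κ u l u') hδ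

end Tadpole

section Words
include hA hS hW hδ hw hCw hδw

/-- [folklore] **THE PACKED ONE-LOOP WORD IS THE JOINT PAIRING OF THE FINE HESSIAN WITH THE WEIGHTS**:
`hessKer A (μ y ↦ Σ_κ wsum (w μ y κ) (S κ)) (μ y ν y′ ↦ Σ_κ Σ_l wsum (w μ y κ) (u ↦ wsum (w ν y′ l) (W κ u l))) μ ν z
 = Σ_κ Σ_l Σ'_{q} w μ 0 κ q.1 · w ν z l q.2 · fineHessA A S W κ l q.1 q.2` (given the summabilities `hsum` of the two joint families, which
`TwoBondWardPairingJoint.summable_prod_slice` supplies from the decay letters). -/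
theorem hessKer_packed_eq_joint_pairing (μ ν : Fin 4) (z : Site 4)
    (hsumT : ∀ κ l, Summable fun q : Site 4 × Site 4 => w μ 0 κ q.1 * w ν z l q.2 * tadpole A (W κ q.1 l q.2))
    (hsumB : ∀ κ l, Summable fun q : Site 4 × Site 4 => w μ 0 κ q.1 * w ν z l q.2 * bubble A (S κ q.1) (S l q.2)) :
    hessKer A (fun μ y => ∑ κ : Fin 4, wsum (w μ y κ) (S κ))
        (fun μ y ν y' => ∑ κ : Fin 4, ∑ l : Fin 4, wsum (w μ y κ) (fun u => wsum (w ν y' l) (W κ u l))) μ ν z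
      = ∑ κ : Fin 4, ∑ l : Fin 4, ∑' q : Site 4 × Site 4, w μ 0 κ q.1 * w ν z l q.2 * fineHessA A S W κ l q.1 q.2 := by
  unfold ExpKernelCalculus.hessKer
  rw [tadpole_packed hA hW hδ hw hCw hδw μ 0 ν z, bubble_packed hA hS hδ hw hCw hδw μ 0 ν z, Finset.mul_sum, Finset.mul_sum,
    ← Finset.sum_sub_distrib]
  refine Finset.sum_congr rfl fun κ _ => ?_
  rw [Finset.mul_sum, Finset.mul_sum, ← Finset.sum_sub_distrib]
  refine Finset.sum_congr rfl fun l _ => ?_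
  rw [← tsum_mul_left, ← tsum_mul_left, ← ((hsumT κ l).mul_left (1 / 2)).tsum_sub ((hsumB κ l).mul_left (1 / 2))]
  refine tsum_congr fun q => ?_
  rw [fineHessA_apply, tadpoleTableA_apply, bubbleTableA_apply]
  ring

end Words

end Summit.QuantumFields.BalabanUV.Beta.D1BFx.PackedWordPairing

end
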